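/-
Origin: expansion seat `planner-pub-hodgecm-mc-axioms-1-g16-0`, handover #8 2026-08-21T00:37Z md5 dc633c722ed4 (NEW; 202 l.; import `HodgeCM.Model.LiuDictionaryInstanceTwist` only; ns `HodgeCM.Model.SplitLine`; KERNEL, the CARRIER-LEVEL corollaries of the record twist `SplitLine.twistBy` (#7) over theta-3-g27's twist API (#S14 r3): `finPairCharOf_eq_mul` (ĉ_f(k,u) = twistCharV ĉ k · twistCharW ĉ u) · `finPairRep_twistBy_apply` (ω_f^{p.twistBy ĉ hĉ}(q) f = ĉ_f(q) • ω_f^{p}(q) f := r3 `finPairRep_twist … ĉ p.hs (p.twistBy ĉ hĉ).hs q f`) · `finPairRepV_twistBy_apply` ∕ `finPairRepW_twistBy_apply` (members, := r3 `finPairRepV_twist` ∕ `finPairRepW_twist`) · `def twistCharWMul ĉ χ : p.CharW := twistCharW ĉ * χ` + `_apply` (rfl) · **`def Ω_twistBy ĉ hĉ (hχ : ∀ u, χ' u = twistCharW ĉ u * χ u) : (p.twistBy ĉ hĉ).Ω ιV χ' ≃ₗ[ℂ] p.Ω ιV χ`** (:= `asModuleEquiv ≫ r3 weilCoinvTwistEquiv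 … ĉ p.hs (p.twistBy ĉ hĉ).hs hχ ≫ asModuleEquiv.symm`; ℂ-LINEAR comparison of CARRIERS only — per theta-3-g27's word STATUS 2026-08-21T00:24:26Z the docstrings say explicitly it is NOT a `ℂ[U(V)(𝔸_f)]`-isomorphism `Ω(p ⊗ ĉ, χ') ≅ Ω(p, χ)` (different summands of [Liu21] Prop. 4.13 unless ĉ_V ∘ ιV = 1) but onto the ĉ_V∘ιV-TWISTED module) · **`Ω_twistBy_rep`** (INTERTWINING LAW: E (((weilCoinv … χ' (p.twistBy ĉ hĉ).hs).comp ιV) k x) = twistCharV ĉ (ιV k) • ((weilCoinv … χ p.hs).comp ιV) k (E x) := r3 `weilCoinvTwistEquiv_weilCoinv … (ιV k) x`) · **`Ω_twistBy_eq_twist`** (same in `SeesawScalar.twist ((twistCharV ĉ).comp ιV) ((weilCoinv … χ p.hs).comp ιV)` currency, as r3's `_eq_twist`) · `Ω_twistBy_of_smul` (module currency: E ((MonoidAlgebra.of ℂ _ k : adelicAlgebra V) • x) = twistCharV ĉ (ιV k) • ((of k) • E x)) + the `Module (adelicAlgebra V)` plumbing example. CERT lean-direct (1 process, nice 19, elan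 4.32.0, `-DautoImplicit=false`) over the RUN-67 PKG oleans of record after GO #2₆₇ (lane idle, result l.61; symlink overlay `lean/J3om/olib`): rc 0 ∕ 48 s ∕ 0 warn ∕ 0 proof holes `farm/logs/j3om-6.log`; `#print axioms` 10 ∕ 10 ⊆ {propext, Classical.choice, Quot.sound}, `proof-holeAx` 0 `farm/logs/j3om-axioms.log` bdcb9ca0b46d; placeholder-token grep 0; source `lean/J3om/src/`; NAME LIST (theorems): `HodgeCM.Model.SplitLine.finPairRep_twistBy_apply` · `HodgeCM.Model.SplitLine.Ω_twistBy_rep` · `HodgeCM.Model.SplitLine.Ω_twistBy_eq_twist`) (`HOME/mc/pub-hodgecm-mc-axioms-1-g16/stage68/HodgeCM/Model/LiuDictionaryInstanceTwistOmega.lean`, md5 dc633c722ed4, 202 lines);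
landed by the second packager p2 gen 16 (p2-g16) in gate run 68 as `HodgeCM/Model/LiuDictionaryInstanceTwistOmega.lean` (verbatim).
-/
/-
unit pub-hodgecm-mc-axioms-1-g16 (gen 16), seat planner-pub-hodgecm-mc-axioms-1-g16-0, 2026-08-21.
(J3) DATUM SEAM 2, option (C), leaf r2: the CARRIER-LEVEL corollaries of the record twist `SplitLine.twistBy` (leaf r1, RUN 67 #7)
over theta-3-g27's representation-level twist API (#S14 r3, RUN 67: `HodgeCM.WeilCoinv.finPairRep_twist`,
`weilCoinvTwistEquiv`, `weilCoinvTwistEquiv_weilCoinv`).  KERNEL definitions and theorems only: no record, no cited sentence;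
E / row 9 / MODEL-N untouched; nothing imports this file.
-/
import Summits.HodgeConjecture.HodgeCM.Model.LiuDictionaryInstanceTwist

/-!
# (J3) The twisted record's carriers: `Ω(p ⊗ ĉ, ĉ_W · χ) ≅ Ω(p, χ)`, `U(J_V)(𝔸_f)`-action twisted by `ĉ_V`

For an index record `p : SplitLine …` (a hermitian line with a compatible pair splitting `p.s`), a character `ĉ` of the big
group `G₁(𝔸) = U(J_V ⊗ J_W)(𝔸)` trivial on `G₁(L⁺)`, and the twisted record `p ⊗ ĉ := p.twistBy ĉ hĉ` of leaf r1:

* `finPairCharOf_eq_mul` — the finite pair character of r1 factors as `ĉ_f(k, u) = ĉ_V(k) · ĉ_W(u)` through theta-3's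
  `twistCharV` / `twistCharW`;
* `finPairRep_twistBy_apply` (and the `V`/`W` members) — `ω_f^{p ⊗ ĉ}(k, u) = ĉ_f(k, u) • ω_f^{p}(k, u)` on `𝒮((𝔸_f)^3)`
  (theta-3's `finPairRep_twist` at `hs' := (p ⊗ ĉ).hs`);
* `Ω_twistBy` — for `χ' = ĉ_W · χ`, a `ℂ`-LINEAR isomorphism from the carrier of `Ω(p ⊗ ĉ, χ')` onto the carrier of `Ω(p, χ)`
  (#4 `SplitLine.Ω`, pulled back along `ιV`; theta-3's `weilCoinvTwistEquiv` between the `Representation.asModule` synonyms — both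
  are quotients of `𝒮((𝔸_f)^3)` by the SAME relation submodule), together with its INTERTWINING LAW `Ω_twistBy_rep` /
  `Ω_twistBy_eq_twist`: it intertwines the `U(J_V)(𝔸_f)`-action of `Ω(p ⊗ ĉ, χ')` with the `ĉ_V ∘ ιV`-TWISTED action
  `SeesawScalar.twist (ĉ_V ∘ ιV) Ω(p, χ)` ([GelbartRogawski1991] §3.1 Remark p. 457: `ω_{s ⊗ ĉ} = ω_s ⊗ ĉ`).

CAUTION (theta-3-g27's word, STATUS 2026-08-21T00:24:26Z): `Ω_twistBy` is NOT an isomorphism of `ℂ[U(V)(𝔸_f)]`-modules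
`Ω(p ⊗ ĉ, χ') ≅ Ω(p, χ)` — unless `ĉ_V ∘ ιV = 1` these are DIFFERENT summands of [Liu21] Prop. 4.13 (different `μ`); what it gives
is `Ω(p ⊗ ĉ, ĉ_W · χ) ≅ Ω(p, χ) ⊗ (ĉ_V ∘ ιV)` as `U(V)(𝔸_f)`-modules.  The `ℂ[↥V.adelicFin]`-linear packaging against the
twisted-representation synonym composes with sinst-1's (γ) read-back (`HodgeCM.TwistedCoinv.coinvCongrTwist`, RUN 67 #1253).
-/

noncomputable section

open Function Set
open NumberField
open Literature.NumberTheory.Automorphic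
open Literature.NumberTheory.GelbartRogawski1991 Literature.NumberTheory.GelbartRogawski1991.UnitaryDualPair
open Literature.NumberTheory.Weil1964
open Literature.RepresentationTheory (SeesawScalar.twist SeesawScalar.twist_apply)

namespace HodgeCM.Model

variable {L : CMField} {ι₁ : (L : Type) →+* ℂ} {V : HermSpace3 L ι₁}
variable {JV : Matrix (Fin 3) (Fin 3) (L : Type)} {TV : Matrix (Fin 3) (Fin 3) ↥(maximalRealSubfield (L : Type))}
  {δ : (L : Type)} {hcδ : IsCMField.complexConj (L : Type) δ = -δ} {hδ : δ ≠ 0} {d : ↥(maximalRealSubfield (L : Type))}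
  {hd : δ * δ = algebraMap _ (L : Type) d} {hV : TV.IsSymm} {hVd : IsUnit TV.det}
  {hJV : JV = TV.map (algebraMap _ (L : Type))}

namespace SplitLine

variable (p : SplitLine JV TV hcδ hδ hd hV hVd hJV)
  (ιV : ↥V.adelicFin →*
    ↥(UnitaryGroup.finAdelic (↥(maximalRealSubfield (L : Type))) (L : Type) (IsCMField.complexConj (L : Type)) 3 JV))

/-! ## §1. The finite pair character factors through theta-3's `twistCharV` / `twistCharW` -/

/-- `ĉ_f(k, u) = ĉ_V(k) · ĉ_W(u)` (`pairMap (x, y) = (x ⊗ 1)(1 ⊗ y)` and `ĉ` is multiplicative). [folklore] -/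
theorem finPairCharOf_eq_mul (ĉ : p.BigChar)
    (q : ↥(UnitaryGroup.finAdelic (↥(maximalRealSubfield (L : Type))) (L : Type) (IsCMField.complexConj (L : Type)) 3 JV) ×
      ↥(UnitaryGroup.finAdelic (↥(maximalRealSubfield (L : Type))) (L : Type) (IsCMField.complexConj (L : Type)) 1 p.JW)) :
    p.finPairCharOf ĉ q =
      HodgeCM.WeilCoinv.twistCharV (↥(maximalRealSubfield (L : Type))) (L : Type) (IsCMField.complexConj (L : Type)) 3 1 JV
          p.JW ĉ q.1 *
        HodgeCM.WeilCoinv.twistCharW (↥(maximalRealSubfield (L : Type))) (L : Type) (IsCMField.complexConj (L : Type)) 3 1 JV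
          p.JW ĉ q.2 := by
  rw [finPairCharOf_apply, pairMap_apply, map_mul, HodgeCM.WeilCoinv.finPairToAdelic_apply,
    HodgeCM.WeilCoinv.twistCharV_apply, HodgeCM.WeilCoinv.twistCharW_apply]

/-! ## §2. The finite Weil representation of the twisted record -/

/-- **`ω_f^{p ⊗ ĉ}(k, u) = ĉ_f(k, u) • ω_f^{p}(k, u)`** on `𝒮((𝔸_{L⁺,f})^3)` (theta-3's `finPairRep_twist` at the twisted
record's compatibility witness `(p ⊗ ĉ).hs`). [cite: GelbartRogawski1991, §3.1 Remark p. 457 L4–13] -/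
theorem finPairRep_twistBy_apply (ĉ : p.BigChar) (hĉ : p.IsRatTrivial ĉ)
    (q : ↥(UnitaryGroup.finAdelic (↥(maximalRealSubfield (L : Type))) (L : Type) (IsCMField.complexConj (L : Type)) 3 JV) ×
      ↥(UnitaryGroup.finAdelic (↥(maximalRealSubfield (L : Type))) (L : Type) (IsCMField.complexConj (L : Type)) 1 p.JW))
    (f : FinSB (↥(maximalRealSubfield (L : Type))) (Fin 3 × Fin 1)) :
    HodgeCM.WeilCoinv.finPairRep (↥(maximalRealSubfield (L : Type))) (L : Type) (IsCMField.complexConj (L : Type)) 3 1 p.e JV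
        p.JW hcδ hδ hd hV p.hW hVd p.hWd hJV p.hJW (p.twistBy ĉ hĉ).hs q f =
      ((p.finPairCharOf ĉ q : ℂˣ) : ℂ) •
        HodgeCM.WeilCoinv.finPairRep (↥(maximalRealSubfield (L : Type))) (L : Type) (IsCMField.complexConj (L : Type)) 3 1 p.e
          JV p.JW hcδ hδ hd hV p.hW hVd p.hWd hJV p.hJW p.hs q f := by
  rw [finPairCharOf_eq_mul]
  exact HodgeCM.WeilCoinv.finPairRep_twist (↥(maximalRealSubfield (L : Type))) (L : Type) (IsCMField.complexConj (L : Type))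
    3 1 p.e JV p.JW hcδ hδ hd hV p.hW hVd p.hWd hJV p.hJW ĉ p.hs (p.twistBy ĉ hĉ).hs q f

/-- `U(J_V)`-member: `ω_f^{p ⊗ ĉ}(k, 1) = ĉ_V(k) • ω_f^{p}(k, 1)`. [folklore] -/
theorem finPairRepV_twistBy_apply (ĉ : p.BigChar) (hĉ : p.IsRatTrivial ĉ)
    (k : ↥(UnitaryGroup.finAdelic (↥(maximalRealSubfield (L : Type))) (L : Type) (IsCMField.complexConj (L : Type)) 3 JV))
    (f : FinSB (↥(maximalRealSubfield (L : Type))) (Fin 3 × Fin 1)) :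
    HodgeCM.WeilCoinv.finPairRepV (↥(maximalRealSubfield (L : Type))) (L : Type) (IsCMField.complexConj (L : Type)) 3 1 p.e JV
        p.JW hcδ hδ hd hV p.hW hVd p.hWd hJV p.hJW (p.twistBy ĉ hĉ).hs k f =
      ((HodgeCM.WeilCoinv.twistCharV (↥(maximalRealSubfield (L : Type))) (L : Type) (IsCMField.complexConj (L : Type)) 3 1 JV
            p.JW ĉ k : ℂˣ) : ℂ) •
        HodgeCM.WeilCoinv.finPairRepV (↥(maximalRealSubfield (L : Type))) (L : Type) (IsCMField.complexConj (L : Type)) 3 1 p.e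
          JV p.JW hcδ hδ hd hV p.hW hVd p.hWd hJV p.hJW p.hs k f :=
  HodgeCM.WeilCoinv.finPairRepV_twist (↥(maximalRealSubfield (L : Type))) (L : Type) (IsCMField.complexConj (L : Type)) 3 1
    p.e JV p.JW hcδ hδ hd hV p.hW hVd p.hWd hJV p.hJW ĉ p.hs (p.twistBy ĉ hĉ).hs k f

/-- `U(J_W)`-member: `ω_f^{p ⊗ ĉ}(1, u) = ĉ_W(u) • ω_f^{p}(1, u)`. [folklore] -/
theorem finPairRepW_twistBy_apply (ĉ : p.BigChar) (hĉ : p.IsRatTrivial ĉ)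
    (u : ↥(UnitaryGroup.finAdelic (↥(maximalRealSubfield (L : Type))) (L : Type) (IsCMField.complexConj (L : Type)) 1 p.JW))
    (f : FinSB (↥(maximalRealSubfield (L : Type))) (Fin 3 × Fin 1)) :
    HodgeCM.WeilCoinv.finPairRepW (↥(maximalRealSubfield (L : Type))) (L : Type) (IsCMField.complexConj (L : Type)) 3 1 p.e JV
        p.JW hcδ hδ hd hV p.hW hVd p.hWd hJV p.hJW (p.twistBy ĉ hĉ).hs u f =
      ((HodgeCM.WeilCoinv.twistCharW (↥(maximalRealSubfield (L : Type))) (L : Type) (IsCMField.complexConj (L : Type)) 3 1 JV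
            p.JW ĉ u : ℂˣ) : ℂ) •
        HodgeCM.WeilCoinv.finPairRepW (↥(maximalRealSubfield (L : Type))) (L : Type) (IsCMField.complexConj (L : Type)) 3 1 p.e
          JV p.JW hcδ hδ hd hV p.hW hVd p.hWd hJV p.hJW p.hs u f :=
  HodgeCM.WeilCoinv.finPairRepW_twist (↥(maximalRealSubfield (L : Type))) (L : Type) (IsCMField.complexConj (L : Type)) 3 1
    p.e JV p.JW hcδ hδ hd hV p.hW hVd p.hWd hJV p.hJW ĉ p.hs (p.twistBy ĉ hĉ).hs u f

/-! ## §3. The carriers of the twisted record -/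

/-- the twisted character `ĉ_W · χ` of `U(W)(𝔸_f) = E¹(𝔸_f)`: the character at which the twisted record `p ⊗ ĉ` carries the
module `Ω(p, χ)` (same relation submodule, theta-3's `ker_weilCoinv_twist`). [folklore] -/
def twistCharWMul (ĉ : p.BigChar) (χ : p.CharW) : p.CharW :=
  HodgeCM.WeilCoinv.twistCharW (↥(maximalRealSubfield (L : Type))) (L : Type) (IsCMField.complexConj (L : Type)) 3 1 JV p.JW ĉ *
    χ

/-- (Ported verbatim from the HodgeCMPerL package; no docstring in the source.) -/
@[simp] theorem twistCharWMul_apply (ĉ : p.BigChar) (χ : p.CharW)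
    (u : ↥(UnitaryGroup.finAdelic (↥(maximalRealSubfield (L : Type))) (L : Type) (IsCMField.complexConj (L : Type)) 1 p.JW)) :
    p.twistCharWMul ĉ χ u =
      HodgeCM.WeilCoinv.twistCharW (↥(maximalRealSubfield (L : Type))) (L : Type) (IsCMField.complexConj (L : Type)) 3 1 JV p.JW
          ĉ u * χ u := rfl

/-- **the twist comparison `E : Ω(p ⊗ ĉ, χ') ≃ₗ[ℂ] Ω(p, χ)` of CARRIERS, for `χ' = ĉ_W · χ`** — `ℂ`-linear only: it intertwines
`Ω(p ⊗ ĉ, χ')` with the `ĉ_V ∘ ιV`-TWIST `SeesawScalar.twist (ĉ_V ∘ ιV) Ω(p, χ)` (`Ω_twistBy_eq_twist`), NOT with `Ω(p, χ)` itself.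
The two carriers (#4 `SplitLine.Ω`, `Representation.asModule` of the pulled-back Weil coinvariants) are quotients of `𝒮((𝔸_f)^3)` by
the SAME submodule; the map is `mk f ↦ mk f` (theta-3's `weilCoinvTwistEquiv` between the `asModule` synonyms). [folklore] -/
def Ω_twistBy (ĉ : p.BigChar) (hĉ : p.IsRatTrivial ĉ) {χ χ' : p.CharW}
    (hχ : ∀ u, χ' u =
      HodgeCM.WeilCoinv.twistCharW (↥(maximalRealSubfield (L : Type))) (L : Type) (IsCMField.complexConj (L : Type)) 3 1 JV p.JW
          ĉ u * χ u) :
    (p.twistBy ĉ hĉ).Ω ιV χ' ≃ₗ[ℂ] p.Ω ιV χ :=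
  (Representation.asModuleEquiv _).trans
    ((HodgeCM.WeilCoinv.weilCoinvTwistEquiv (↥(maximalRealSubfield (L : Type))) (L : Type) (IsCMField.complexConj (L : Type)) 3 1
          p.e JV p.JW hcδ hδ hd hV p.hW hVd p.hWd hJV p.hJW ĉ p.hs (p.twistBy ĉ hĉ).hs hχ).trans
      (Representation.asModuleEquiv _).symm)

/-- **THE INTERTWINING LAW** of `Ω_twistBy`: `E (Ω(p ⊗ ĉ, χ')(k) x) = ĉ_V(ιV k) • Ω(p, χ)(k) (E x)` — i.e.
`Ω(p ⊗ ĉ, ĉ_W · χ) ≅ Ω(p, χ) ⊗ (ĉ_V ∘ ιV)` as `U(V)(𝔸_f)`-modules, NOT `≅ Ω(p, χ)` (theta-3's `weilCoinvTwistEquiv_weilCoinv`).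
[cite: GelbartRogawski1991, §3.1 Remark p. 457 L4–13] -/
theorem Ω_twistBy_rep (ĉ : p.BigChar) (hĉ : p.IsRatTrivial ĉ) {χ χ' : p.CharW}
    (hχ : ∀ u, χ' u =
      HodgeCM.WeilCoinv.twistCharW (↥(maximalRealSubfield (L : Type))) (L : Type) (IsCMField.complexConj (L : Type)) 3 1 JV p.JW
          ĉ u * χ u)
    (k : ↥V.adelicFin) (x : (p.twistBy ĉ hĉ).Ω ιV χ') :
    p.Ω_twistBy ιV ĉ hĉ hχ
        (((HodgeCM.WeilCoinv.weilCoinv (↥(maximalRealSubfield (L : Type))) (L : Type) (IsCMField.complexConj (L : Type)) 3 1 p.e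
              JV p.JW hcδ hδ hd hV p.hW hVd p.hWd hJV p.hJW χ' (p.twistBy ĉ hĉ).hs).comp ιV) k x) =
      ((HodgeCM.WeilCoinv.twistCharV (↥(maximalRealSubfield (L : Type))) (L : Type) (IsCMField.complexConj (L : Type)) 3 1 JV
            p.JW ĉ (ιV k) : ℂˣ) : ℂ) •
        ((HodgeCM.WeilCoinv.weilCoinv (↥(maximalRealSubfield (L : Type))) (L : Type) (IsCMField.complexConj (L : Type)) 3 1 p.e
              JV p.JW hcδ hδ hd hV p.hW hVd p.hWd hJV p.hJW χ p.hs).comp ιV) k (p.Ω_twistBy ιV ĉ hĉ hχ x) :=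
  HodgeCM.WeilCoinv.weilCoinvTwistEquiv_weilCoinv (↥(maximalRealSubfield (L : Type))) (L : Type)
    (IsCMField.complexConj (L : Type)) 3 1 p.e JV p.JW hcδ hδ hd hV p.hW hVd p.hWd hJV p.hJW ĉ p.hs (p.twistBy ĉ hĉ).hs hχ
    (ιV k) x

/-- the same law in `SeesawScalar.twist` currency: `E ∘ Ω(p ⊗ ĉ, χ')(k) = (SeesawScalar.twist (ĉ_V ∘ ιV) Ω(p, χ))(k) ∘ E` — the
`U(V)(𝔸_f)`-module met by `E` is the `ĉ_V ∘ ιV`-TWISTED `Ω(p, χ)` (theta-3's `weilCoinvTwistEquiv_weilCoinv_eq_twist`). [folklore] -/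
theorem Ω_twistBy_eq_twist (ĉ : p.BigChar) (hĉ : p.IsRatTrivial ĉ) {χ χ' : p.CharW}
    (hχ : ∀ u, χ' u =
      HodgeCM.WeilCoinv.twistCharW (↥(maximalRealSubfield (L : Type))) (L : Type) (IsCMField.complexConj (L : Type)) 3 1 JV p.JW
          ĉ u * χ u)
    (k : ↥V.adelicFin) (x : (p.twistBy ĉ hĉ).Ω ιV χ') :
    p.Ω_twistBy ιV ĉ hĉ hχ
        (((HodgeCM.WeilCoinv.weilCoinv (↥(maximalRealSubfield (L : Type))) (L : Type) (IsCMField.complexConj (L : Type)) 3 1 p.e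
              JV p.JW hcδ hδ hd hV p.hW hVd p.hWd hJV p.hJW χ' (p.twistBy ĉ hĉ).hs).comp ιV) k x) =
      SeesawScalar.twist
          ((HodgeCM.WeilCoinv.twistCharV (↥(maximalRealSubfield (L : Type))) (L : Type) (IsCMField.complexConj (L : Type)) 3 1 JV
                p.JW ĉ).comp ιV)
          ((HodgeCM.WeilCoinv.weilCoinv (↥(maximalRealSubfield (L : Type))) (L : Type) (IsCMField.complexConj (L : Type)) 3 1
                p.e JV p.JW hcδ hδ hd hV p.hW hVd p.hWd hJV p.hJW χ p.hs).comp ιV) k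
        (p.Ω_twistBy ιV ĉ hĉ hχ x) := by
  rw [SeesawScalar.twist_apply]
  exact p.Ω_twistBy_rep ιV ĉ hĉ hχ k x

set_option synthInstance.maxHeartbeats 200000 in
/-- the same law in MODULE currency: for the generator `of k` of `ℂ[↥V.adelicFin]`,
`Ω_twistBy (of k • x) = ĉ_V(ιV k) • (of k • Ω_twistBy x)`. [folklore] -/
theorem Ω_twistBy_of_smul (ĉ : p.BigChar) (hĉ : p.IsRatTrivial ĉ) {χ χ' : p.CharW}
    (hχ : ∀ u, χ' u =
      HodgeCM.WeilCoinv.twistCharW (↥(maximalRealSubfield (L : Type))) (L : Type) (IsCMField.complexConj (L : Type)) 3 1 JV p.JW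
          ĉ u * χ u)
    (k : ↥V.adelicFin) (x : (p.twistBy ĉ hĉ).Ω ιV χ') :
    p.Ω_twistBy ιV ĉ hĉ hχ ((MonoidAlgebra.of ℂ ↥V.adelicFin k : adelicAlgebra V) • x) =
      ((HodgeCM.WeilCoinv.twistCharV (↥(maximalRealSubfield (L : Type))) (L : Type) (IsCMField.complexConj (L : Type)) 3 1 JV
            p.JW ĉ (ιV k) : ℂˣ) : ℂ) •
        ((MonoidAlgebra.of ℂ ↥V.adelicFin k : adelicAlgebra V) • p.Ω_twistBy ιV ĉ hĉ hχ x) := by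
  have h := p.Ω_twistBy_rep ιV ĉ hĉ hχ k x
  simp only [MonoidAlgebra.of_apply, Representation.single_smul, one_smul, MonoidHom.coe_comp, Function.comp_apply] at h ⊢
  exact h

/-- plumbing check: source and target of `Ω_twistBy` are carriers of the SAME dictionary shape. -/
example (ĉ : p.BigChar) (hĉ : p.IsRatTrivial ĉ) (χ' : p.CharW) : Module (adelicAlgebra V) ((p.twistBy ĉ hĉ).Ω ιV χ') :=
  inferInstance

end SplitLine

end HodgeCM.Model

end
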